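import Mathlib
import Summits.KontsevichZagierPeriods.Zeta5Search.RecordCellDAtlas
import HarnessLib

/-!
# ζ(5) search — class atlas of the record ray at `7n < p < 7.5n`, part 2: the non-minimal classes have `E_x ≥ −7`

Cell `pub-zeta5` (HONEST FRAMING: systematic search; no irrationality claim unless certified), P1 prover seat
generation 6; continues `RecordCellDAtlas.lean`.  For `x < p` outside `MinT1 ∪ MinS ∪ MinT2` the class exponent
`E_x = classExp (bRec n) p x` is at least `−7` (`classExp_ge_of_notMin`; gen-2 g9's face certificate D1/D2, REPORT-gen2-g9 §8, here
proved for all `n` by hand), by the position of `y₁ = x + p − 7n`: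
`x + p < 11n` (two outer zeros on each side of at most three poles), `11n ≤ x+p < 12n` (neutral point, `(0,−6,−4|−3)`),
`12n ≤ x+p < 13n` off `MinT1`, `13n ≤ x+p < 14n` off `MinS` (including the self-conjugate class `2x + 4p = 41n`, whose even centre has
net exponent `−5`), `14n ≤ x+p` off `MinT2`.  Hence `ν_x ≥ −7` there as well.  Exact arithmetic on the ray; nothing about irrationality.
-/

open Finset

namespace Summit.KontsevichZagierPeriods.Zeta5Search.CellD

open Summit.KontsevichZagierPeriods.Zeta5Search.ClusterValuation
open Summit.KontsevichZagierPeriods.Zeta5Search.CasoratianValuation (shift)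
open Summit.KontsevichZagierPeriods.Zeta5Search.BigPrime (block shift_zero)
open Summit.KontsevichZagierPeriods.Zeta5Search.CellA

/-! ### §4 Every other class has `E_x ≥ −7` -/

section NotMin

variable {n p x : ℕ} (hp : 14 * n < 2 * p) (hp' : 2 * p < 15 * n) (hx : x < p)

include hp hp' hx in
/-- Region `x + p < 11n` (`y₁ < 4n`): six points `(1, 1, e₂, e₃, e₄, 1)` with `e₂ + e₃ + e₄ ≥ −10`. -/
theorem classExp_R0 (h11 : x + p < 11 * n) : -7 ≤ classExp (bRec n) p x := by
  have e0 : netExp (bRec n) x = 1 := by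
    rw [netExp_bRec_of_ne n x (by omega), dep7_low (by omega)]; norm_num
  have e1 : netExp (bRec n) (x + p) = 1 := by
    rw [netExp_bRec_of_ne n (x + p) (by omega), dep7_low (by omega)]; norm_num
  have a1 : x + 2 * p < 15 * n → netExp (bRec n) (x + 2 * p) = -3 := fun h => by
    rw [netExp_bRec_of_ne n (x + 2 * p) (by omega), dep7_lower (by norm_num : 4 ≤ 7) (by omega) (by omega)]; norm_num
  have a2 : 15 * n ≤ x + 2 * p → x + 2 * p < 16 * n → netExp (bRec n) (x + 2 * p) = -4 := fun h h' => by
    rw [netExp_bRec_of_ne n (x + 2 * p) (by omega), dep7_lower (by norm_num : 5 ≤ 7) (by omega) (by omega)]; norm_num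
  have a3 : 16 * n ≤ x + 2 * p → x + 2 * p < 17 * n → netExp (bRec n) (x + 2 * p) = -5 := fun h h' => by
    rw [netExp_bRec_of_ne n (x + 2 * p) (by omega), dep7_lower (by norm_num : 6 ≤ 7) (by omega) (by omega)]; norm_num
  have a4 : 17 * n ≤ x + 2 * p → netExp (bRec n) (x + 2 * p) = -6 := fun h => by
    rw [netExp_bRec_of_ne n (x + 2 * p) (by omega), dep7_well (by omega) (by omega)]; norm_num
  have b1 : x + 3 * p ≤ 24 * n → netExp (bRec n) (x + 3 * p) = -6 := fun h => by
    rw [netExp_bRec_of_ne n (x + 3 * p) (by omega), dep7_well (by omega) (by omega)]; norm_num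
  have b2 : 24 * n < x + 3 * p → x + 3 * p ≤ 25 * n → netExp (bRec n) (x + 3 * p) = -5 := fun h h' => by
    rw [netExp_bRec_of_ne n (x + 3 * p) (by omega), dep7_upper (by norm_num : 6 ≤ 7) (by omega) (by omega)]; norm_num
  have b3 : 25 * n < x + 3 * p → netExp (bRec n) (x + 3 * p) = -4 := fun h => by
    rw [netExp_bRec_of_ne n (x + 3 * p) (by omega), dep7_upper (by norm_num : 5 ≤ 7) (by omega) (by omega)]; norm_num
  have c1 : x + 4 * p ≤ 29 * n → netExp (bRec n) (x + 4 * p) = -1 := fun h => by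
    rw [netExp_bRec_of_ne n (x + 4 * p) (by omega), dep7_upper (by norm_num : 2 ≤ 7) (by omega) (by omega)]; norm_num
  have c2 : 29 * n < x + 4 * p → x + 4 * p ≤ 30 * n → netExp (bRec n) (x + 4 * p) = 0 := fun h h' => by
    rw [netExp_bRec_of_ne n (x + 4 * p) (by omega), dep7_upper (by norm_num : 1 ≤ 7) (by omega) (by omega)]; norm_num
  have c3 : 30 * n < x + 4 * p → netExp (bRec n) (x + 4 * p) = 1 := fun h => by
    rw [netExp_bRec_of_ne n (x + 4 * p) (by omega), dep7_high (by omega)]; norm_num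
  have e5 : netExp (bRec n) (x + 5 * p) = 1 := by
    rw [netExp_bRec_of_ne n (x + 5 * p) (by omega), dep7_high (by omega)]; norm_num
  have hE := classExp_ge_six hp hp' hx (by omega)
  omega

include hp hp' hx in
/-- Region `11n ≤ x + p < 12n` (`y₁ ∈ [4n,5n)`): `(1, 0, −6, −4|−3, 1 [,1])`, and the sixth point is present when `e₃ = −4`. -/
theorem classExp_R1 (h11 : 11 * n ≤ x + p) (h12 : x + p < 12 * n) : -7 ≤ classExp (bRec n) p x := by
  have e0 : netExp (bRec n) x = 1 := by
    rw [netExp_bRec_of_ne n x (by omega), dep7_low (by omega)]; norm_num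
  have e1 : netExp (bRec n) (x + p) = 0 := by
    rw [netExp_bRec_of_ne n (x + p) (by omega), dep7_lower (by norm_num : 1 ≤ 7) (by omega) (by omega)]; norm_num
  have e2 : netExp (bRec n) (x + 2 * p) = -6 := by
    rw [netExp_bRec_of_ne n (x + 2 * p) (by omega), dep7_well (by omega) (by omega)]; norm_num
  have b1 : x + 3 * p ≤ 26 * n → netExp (bRec n) (x + 3 * p) = -4 := fun h => by
    rw [netExp_bRec_of_ne n (x + 3 * p) (by omega), dep7_upper (by norm_num : 5 ≤ 7) (by omega) (by omega)]; norm_num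
  have b2 : 26 * n < x + 3 * p → netExp (bRec n) (x + 3 * p) = -3 := fun h => by
    rw [netExp_bRec_of_ne n (x + 3 * p) (by omega), dep7_upper (by norm_num : 4 ≤ 7) (by omega) (by omega)]; norm_num
  have e4 : netExp (bRec n) (x + 4 * p) = 1 := by
    rw [netExp_bRec_of_ne n (x + 4 * p) (by omega), dep7_high (by omega)]; norm_num
  by_cases h6 : x + 5 * p ≤ 41 * n
  · have e5 : netExp (bRec n) (x + 5 * p) = 1 := by
      rw [netExp_bRec_of_ne n (x + 5 * p) (by omega), dep7_high (by omega)]; norm_num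
    have hE := classExp_ge_six hp hp' hx h6
    omega
  · have hE := classExp_ge_five hp hp' hx h6
    omega

include hp hp' hx in
/-- Region `12n ≤ x + p < 13n` (`y₁ ∈ [5n,6n)`) outside `MinT1`: `(1, −1, −6, −3|−2, 1 [,1])` with `e₃ = −2` or a sixth point. -/
theorem classExp_R2 (h12 : 12 * n ≤ x + p) (h13 : x + p < 13 * n) (hT1 : 27 * n < x + 3 * p ∨ x + 5 * p ≤ 41 * n) :
    -7 ≤ classExp (bRec n) p x := by
  have e0 : netExp (bRec n) x = 1 := by
    rw [netExp_bRec_of_ne n x (by omega), dep7_low (by omega)]; norm_num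
  have e1 : netExp (bRec n) (x + p) = -1 := by
    rw [netExp_bRec_of_ne n (x + p) (by omega), dep7_lower (by norm_num : 2 ≤ 7) (by omega) (by omega)]; norm_num
  have e2 : netExp (bRec n) (x + 2 * p) = -6 := by
    rw [netExp_bRec_of_ne n (x + 2 * p) (by omega), dep7_well (by omega) (by omega)]; norm_num
  have b1 : x + 3 * p ≤ 27 * n → netExp (bRec n) (x + 3 * p) = -3 := fun h => by
    rw [netExp_bRec_of_ne n (x + 3 * p) (by omega), dep7_upper (by norm_num : 4 ≤ 7) (by omega) (by omega)]; norm_num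
  have b2 : 27 * n < x + 3 * p → netExp (bRec n) (x + 3 * p) = -2 := fun h => by
    rw [netExp_bRec_of_ne n (x + 3 * p) (by omega), dep7_upper (by norm_num : 3 ≤ 7) (by omega) (by omega)]; norm_num
  have e4 : netExp (bRec n) (x + 4 * p) = 1 := by
    rw [netExp_bRec_of_ne n (x + 4 * p) (by omega), dep7_high (by omega)]; norm_num
  by_cases h6 : x + 5 * p ≤ 41 * n
  · have e5 : netExp (bRec n) (x + 5 * p) = 1 := by
      rw [netExp_bRec_of_ne n (x + 5 * p) (by omega), dep7_high (by omega)]; norm_num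
    have hE := classExp_ge_six hp hp' hx h6
    omega
  · have hE := classExp_ge_five hp hp' hx h6
    omega

include hp hp' hx in
/-- Region `13n ≤ x + p < 14n` (`y₁ ∈ [6n,7n)`) outside `MinS`: five points `(1, −2, −6|−5, −2|−1, 1)` with `e₃ = −1` or the even
centre at `x + 2p` (`e₂ = −5`, the self-conjugate class). -/
theorem classExp_R3 (h13 : 13 * n ≤ x + p) (h14 : x + p < 14 * n) (hS : 28 * n < x + 3 * p ∨ 2 * x + 4 * p = 41 * n) :
    -7 ≤ classExp (bRec n) p x := by
  have e0 : netExp (bRec n) x = 1 := by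
    rw [netExp_bRec_of_ne n x (by omega), dep7_low (by omega)]; norm_num
  have e1 : netExp (bRec n) (x + p) = -2 := by
    rw [netExp_bRec_of_ne n (x + p) (by omega), dep7_lower (by norm_num : 3 ≤ 7) (by omega) (by omega)]; norm_num
  have a1 : 2 * x + 4 * p ≠ 41 * n → netExp (bRec n) (x + 2 * p) = -6 := fun h => by
    rw [netExp_bRec_of_ne n (x + 2 * p) (by omega), dep7_well (by omega) (by omega)]; norm_num
  have a2 : 2 * x + 4 * p = 41 * n → netExp (bRec n) (x + 2 * p) = -5 := fun h => netExp_centre (by omega)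
  have b1 : x + 3 * p ≤ 28 * n → netExp (bRec n) (x + 3 * p) = -2 := fun h => by
    rw [netExp_bRec_of_ne n (x + 3 * p) (by omega), dep7_upper (by norm_num : 3 ≤ 7) (by omega) (by omega)]; norm_num
  have b2 : 28 * n < x + 3 * p → netExp (bRec n) (x + 3 * p) = -1 := fun h => by
    rw [netExp_bRec_of_ne n (x + 3 * p) (by omega), dep7_upper (by norm_num : 2 ≤ 7) (by omega) (by omega)]; norm_num
  have e4 : netExp (bRec n) (x + 4 * p) = 1 := by
    rw [netExp_bRec_of_ne n (x + 4 * p) (by omega), dep7_high (by omega)]; norm_num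
  have hE := classExp_ge_five hp hp' hx (by omega)
  omega

include hp hp' hx in
/-- Region `14n ≤ x + p` (`y₁ ∈ [7n,8n)`) outside `MinT2`: five points `(1, −3, −6, 0, 1)`. -/
theorem classExp_R4 (h14 : 14 * n ≤ x + p) (hT2 : 29 * n < x + 3 * p) : -7 ≤ classExp (bRec n) p x := by
  have e0 : netExp (bRec n) x = 1 := by
    rw [netExp_bRec_of_ne n x (by omega), dep7_low (by omega)]; norm_num
  have e1 : netExp (bRec n) (x + p) = -3 := by
    rw [netExp_bRec_of_ne n (x + p) (by omega), dep7_lower (by norm_num : 4 ≤ 7) (by omega) (by omega)]; norm_num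
  have e2 : netExp (bRec n) (x + 2 * p) = -6 := by
    rw [netExp_bRec_of_ne n (x + 2 * p) (by omega), dep7_well (by omega) (by omega)]; norm_num
  have e3 : netExp (bRec n) (x + 3 * p) = 0 := by
    rw [netExp_bRec_of_ne n (x + 3 * p) (by omega), dep7_upper (by norm_num : 1 ≤ 7) (by omega) (by omega)]; norm_num
  have e4 : netExp (bRec n) (x + 4 * p) = 1 := by
    rw [netExp_bRec_of_ne n (x + 4 * p) (by omega), dep7_high (by omega)]; norm_num
  have hE := classExp_ge_five hp hp' hx (by omega)
  omega

include hp hp' hx in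
/-- **THE NON-MINIMAL CLASSES**: for `x < p` outside `MinT1 ∪ MinS ∪ MinT2`, `E_x(b(n), p) ≥ −7`. -/
theorem classExp_ge_of_notMin (h1 : x ∉ MinT1 n p) (h2 : x ∉ MinS n p) (h3 : x ∉ MinT2 n p) :
    -7 ≤ classExp (bRec n) p x := by
  rw [mem_minT1] at h1; rw [mem_minS] at h2; rw [mem_minT2] at h3
  by_cases h11 : x + p < 11 * n
  · exact classExp_R0 hp hp' hx h11
  push Not at h11
  by_cases h12 : x + p < 12 * n
  · exact classExp_R1 hp hp' hx h11 h12
  push Not at h12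
  by_cases h13 : x + p < 13 * n
  · refine classExp_R2 hp hp' hx h12 h13 ?_
    by_contra hc; push Not at hc; exact h1 ⟨hx, h12, hc.1, hc.2⟩
  push Not at h13
  by_cases h14 : x + p < 14 * n
  · refine classExp_R3 hp hp' hx h13 h14 ?_
    by_contra hc; push Not at hc; exact h2 ⟨hx, h13, hc.1, hc.2⟩
  push Not at h14
  refine classExp_R4 hp hp' hx h14 ?_
  by_contra hc; push Not at hc; exact h3 ⟨hx, h14, hc⟩

include hp hp' hx in
/-- … hence `ν_x(b(n), p) ≥ −7` there. -/
theorem classNu_ge_of_notMin (h1 : x ∉ MinT1 n p) (h2 : x ∉ MinS n p) (h3 : x ∉ MinT2 n p) :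
    -7 ≤ classNu (bRec n) p x :=
  (classExp_ge_of_notMin hp hp' hx h1 h2 h3).trans (classExp_le_classNu _ _ _)

end NotMin

end Summit.KontsevichZagierPeriods.Zeta5Search.CellD
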